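import Mathlib.Analysis.InnerProductSpace.Adjoint
import Mathlib.Analysis.SpecialFunctions.Complex.CircleAddChar
import Mathlib.Algebra.Group.AddChar
import HarnessLib

/-!
# Isotypic projections of a finite abelian norm-preserving representation, and the characters of `(ℤ/N)³`
# (toolkit for STUB `stub_jointDiagonal` of crux `SqueezedSkewness.SpectralIdentificationL`, stmt-QuantumFields-22796;
# planner ym-idea-6 g8, LINE 2 «low-pass floor», pointers §2 step 4)

Pure operator theory / character theory, def-free (the projections are passed as a variable `Pr` with its defining equation `hPr`).
§A: for a norm-preserving representation `V` of a finite additive commutative group `Γ` on a complex inner-product space and a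
bicharacter `χ` (multiplicative, `conj χ_q(γ) = χ_q(−γ)`, orthogonality relations as hypotheses), the isotypic projections
`Π_q = |Γ|⁻¹ Σ_γ conj χ_q(γ) · V(γ)` satisfy `V(γ) Π_q = χ_q(γ) Π_q = Π_q V(γ)`, `Π_q Π_q' = δ Π_q`, `Σ_q Π_q = 1`, symmetry,
`‖Π_q v‖ ≤ ‖v‖`, commute with every operator commuting with `V`, and Pythagoras `‖v‖² = Σ_q ‖Π_q v‖²`.
§B: the bicharacter `χ_q(γ) = Π_k stdAddChar(q_k γ_k)` of `(ℤ/N)³` (Mathlib `ZMod.stdAddChar`): multiplicativity, conjugation,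
symmetry, the two orthogonality relations, and its value on integer representatives as the lattice phase `exp(2πi q·x/N)`.

Seat `ym-line-fcl-p3` g14 (cell ym-idea-1; free hands).  THEOREMS ONLY (no `def`, no `sorry`).  No OS datum, NT statement or mass gap is
touched.  References: J.-P. Serre, *Linear Representations of Finite Groups* §2.6 (canonical decomposition); M. Reed, B. Simon, *Methods of
Modern Mathematical Physics I* (1980) [cite: ReedSimonI1980, Thm. VI.16].
-/

set_option autoImplicit false

noncomputable section

open scoped InnerProductSpace ComplexConjugate BigOperators
open Complex Finset

namespace Summit.QuantumFields.YangMills.Theorems.SqueezedSkewnessJointDiagonal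

/-! ## §A Isotypic projections of a finite abelian norm-preserving representation -/

section Isotypic

variable {E : Type*} [NormedAddCommGroup E] [InnerProductSpace ℂ E]
variable {Γ : Type*} [AddCommGroup Γ]

/-- A norm-preserving representation satisfies `⟪V γ u, v⟫ = ⟪u, V (−γ) v⟫` (isometries preserve the inner product; `V γ V (−γ) = 1`).
[folklore] -/
theorem inner_rep_left (V : Γ → E →L[ℂ] E) (hV0 : V 0 = 1) (hVadd : ∀ γ γ', V (γ + γ') = V γ * V γ')
    (hVnorm : ∀ γ v, ‖V γ v‖ = ‖v‖) (γ : Γ) (u v : E) : ⟪V γ u, v⟫_ℂ = ⟪u, V (-γ) v⟫_ℂ := by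
  have hiso : ∀ x y : E, ⟪V γ x, V γ y⟫_ℂ = ⟪x, y⟫_ℂ :=
    (LinearMap.norm_map_iff_inner_map_map (V γ)).1 (hVnorm γ)
  have h1 : V γ (V (-γ) v) = v := by
    rw [← mul_apply_eq_comp, ← hVadd, add_neg_cancel, hV0, one_apply_eq_self]
  calc ⟪V γ u, v⟫_ℂ = ⟪V γ u, V γ (V (-γ) v)⟫_ℂ := by rw [h1]
    _ = ⟪u, V (-γ) v⟫_ℂ := hiso u _

variable (χ : Γ → Γ → ℂ) (V : Γ → E →L[ℂ] E)

/-- `|χ_q(γ)| = 1` from `conj χ_q(γ) = χ_q(−γ)` and multiplicativity. [folklore] -/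
theorem norm_bichar (hχadd : ∀ q γ γ', χ q (γ + γ') = χ q γ * χ q γ') (hχzero : ∀ q, χ q 0 = 1)
    (hχconj : ∀ q γ, conj (χ q γ) = χ q (-γ)) (q γ : Γ) : ‖χ q γ‖ = 1 := by
  have h : χ q γ * conj (χ q γ) = 1 := by rw [hχconj, ← hχadd, add_neg_cancel, hχzero]
  have h2 : ‖χ q γ‖ ^ 2 = 1 := by
    have := congrArg (fun z : ℂ => ‖z‖) h
    simpa [Complex.mul_conj, Complex.normSq_eq_norm_sq] using this
  nlinarith [norm_nonneg (χ q γ)]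

variable [Fintype Γ] [DecidableEq Γ] (Pr : Γ → E →L[ℂ] E)

omit [DecidableEq Γ] in
/-- `V(γ') Π_q = χ_q(γ') Π_q`. [folklore] -/
theorem rep_mul_proj (hχadd : ∀ q γ γ', χ q (γ + γ') = χ q γ * χ q γ') (hχconj : ∀ q γ, conj (χ q γ) = χ q (-γ))
    (hVadd : ∀ γ γ', V (γ + γ') = V γ * V γ')
    (hPr : ∀ q, Pr q = ((Fintype.card Γ : ℂ)⁻¹) • ∑ γ, conj (χ q γ) • V γ) (q γ' : Γ) :
    V γ' * Pr q = χ q γ' • Pr q := by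
  rw [hPr q, mul_smul_comm, Finset.mul_sum, smul_comm (χ q γ') ((Fintype.card Γ : ℂ)⁻¹)]
  congr 1
  have step : ∀ γ, V γ' * (conj (χ q γ) • V γ) = conj (χ q γ) • V (γ' + γ) := fun γ => by
    rw [mul_smul_comm, hVadd]
  simp_rw [step]
  rw [Finset.smul_sum]
  -- reindex `γ ↦ γ' + γ`
  have hre : ∑ γ, conj (χ q γ) • V (γ' + γ) = ∑ δ, conj (χ q (δ - γ')) • V δ := by
    refine (Fintype.sum_equiv (Equiv.addLeft γ') _ (fun δ => conj (χ q (δ - γ')) • V δ) (fun γ => ?_))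
    rw [show (Equiv.addLeft γ') γ = γ' + γ from rfl, add_sub_cancel_left]
  rw [hre]
  refine Finset.sum_congr rfl fun δ _ => ?_
  have : χ q (δ - γ') = χ q δ * χ q (-γ') := by rw [sub_eq_add_neg, hχadd]
  rw [this, map_mul, smul_smul]
  congr 1
  have h2 : conj (χ q (-γ')) = χ q γ' := by rw [hχconj, neg_neg]
  rw [h2, mul_comm]

omit [DecidableEq Γ] in
/-- `Π_q V(γ') = χ_q(γ') Π_q`. [folklore] -/
theorem proj_mul_rep (hχadd : ∀ q γ γ', χ q (γ + γ') = χ q γ * χ q γ') (hχconj : ∀ q γ, conj (χ q γ) = χ q (-γ))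
    (hVadd : ∀ γ γ', V (γ + γ') = V γ * V γ')
    (hPr : ∀ q, Pr q = ((Fintype.card Γ : ℂ)⁻¹) • ∑ γ, conj (χ q γ) • V γ) (q γ' : Γ) :
    Pr q * V γ' = χ q γ' • Pr q := by
  rw [hPr q, smul_mul_assoc, Finset.sum_mul, smul_comm (χ q γ') ((Fintype.card Γ : ℂ)⁻¹)]
  congr 1
  have step : ∀ γ, (conj (χ q γ) • V γ) * V γ' = conj (χ q γ) • V (γ + γ') := fun γ => by
    rw [smul_mul_assoc, hVadd]
  simp_rw [step]
  rw [Finset.smul_sum]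
  have hre : ∑ γ, conj (χ q γ) • V (γ + γ') = ∑ δ, conj (χ q (δ - γ')) • V δ := by
    refine (Fintype.sum_equiv (Equiv.addRight γ') _ (fun δ => conj (χ q (δ - γ')) • V δ) (fun γ => ?_))
    rw [show (Equiv.addRight γ') γ = γ + γ' from rfl, add_sub_cancel_right]
  rw [hre]
  refine Finset.sum_congr rfl fun δ _ => ?_
  have : χ q (δ - γ') = χ q δ * χ q (-γ') := by rw [sub_eq_add_neg, hχadd]
  rw [this, map_mul, smul_smul]
  congr 1
  have h2 : conj (χ q (-γ')) = χ q γ' := by rw [hχconj, neg_neg]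
  rw [h2, mul_comm]

/-- `Π_q Π_q' = δ_{q q'} Π_q'`. [folklore] -/
theorem proj_mul_proj (hχadd : ∀ q γ γ', χ q (γ + γ') = χ q γ * χ q γ') (hχconj : ∀ q γ, conj (χ q γ) = χ q (-γ))
    (hχorth : ∀ q q', ∑ γ, χ q γ * conj (χ q' γ) = if q = q' then (Fintype.card Γ : ℂ) else 0)
    (hVadd : ∀ γ γ', V (γ + γ') = V γ * V γ')
    (hPr : ∀ q, Pr q = ((Fintype.card Γ : ℂ)⁻¹) • ∑ γ, conj (χ q γ) • V γ) (q q' : Γ) :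
    Pr q * Pr q' = if q = q' then Pr q' else 0 := by
  have hcard : (Fintype.card Γ : ℂ) ≠ 0 := Nat.cast_ne_zero.2 Fintype.card_ne_zero
  conv_lhs => rw [hPr q]
  rw [smul_mul_assoc, Finset.sum_mul]
  have step : ∀ γ, (conj (χ q γ) • V γ) * Pr q' = (conj (χ q γ) * χ q' γ) • Pr q' := fun γ => by
    rw [smul_mul_assoc, rep_mul_proj χ V Pr hχadd hχconj hVadd hPr, smul_smul]
  simp_rw [step]
  rw [← Finset.sum_smul, smul_smul]
  have hsum : ∑ γ, conj (χ q γ) * χ q' γ = if q = q' then (Fintype.card Γ : ℂ) else 0 := by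
    have := hχorth q' q
    simp_rw [mul_comm (χ q' _)] at this
    rw [this]
    by_cases h : q = q'
    · subst h; simp
    · simp [h, Ne.symm h]
  rw [hsum]
  split_ifs with h
  · rw [inv_mul_cancel₀ hcard, one_smul]
  · rw [mul_zero, zero_smul]

/-- `Σ_q Π_q = 1`. [folklore] -/
theorem sum_proj (hχdual : ∀ γ, ∑ q, conj (χ q γ) = if γ = 0 then (Fintype.card Γ : ℂ) else 0)
    (hV0 : V 0 = 1) (hPr : ∀ q, Pr q = ((Fintype.card Γ : ℂ)⁻¹) • ∑ γ, conj (χ q γ) • V γ) :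
    ∑ q, Pr q = 1 := by
  have hcard : (Fintype.card Γ : ℂ) ≠ 0 := Nat.cast_ne_zero.2 Fintype.card_ne_zero
  simp_rw [hPr]
  rw [← Finset.smul_sum, Finset.sum_comm]
  have step : ∀ γ, ∑ q, conj (χ q γ) • V γ = (if γ = 0 then (Fintype.card Γ : ℂ) else 0) • V γ := fun γ => by
    rw [← Finset.sum_smul, hχdual]
  simp_rw [step, ite_smul, zero_smul]
  rw [Finset.sum_ite_eq' Finset.univ (0 : Γ)]
  simp only [Finset.mem_univ, if_true]
  rw [smul_smul, inv_mul_cancel₀ hcard, one_smul, hV0]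

omit [DecidableEq Γ] in
/-- `Π_q` is symmetric: `⟪Π_q u, v⟫ = ⟪u, Π_q v⟫`. [folklore] -/
theorem inner_proj_left (hχconj : ∀ q γ, conj (χ q γ) = χ q (-γ))
    (hV0 : V 0 = 1) (hVadd : ∀ γ γ', V (γ + γ') = V γ * V γ') (hVnorm : ∀ γ v, ‖V γ v‖ = ‖v‖)
    (hPr : ∀ q, Pr q = ((Fintype.card Γ : ℂ)⁻¹) • ∑ γ, conj (χ q γ) • V γ) (q : Γ) (u v : E) :
    ⟪Pr q u, v⟫_ℂ = ⟪u, Pr q v⟫_ℂ := by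
  have hcr : conj ((Fintype.card Γ : ℂ)⁻¹) = (Fintype.card Γ : ℂ)⁻¹ := by simp
  rw [hPr q]
  simp only [smul_apply, _root_.sum_apply, inner_smul_left, inner_smul_right, sum_inner,
    inner_sum, hcr, Complex.conj_conj]
  congr 1
  -- reindex the right-hand sum by `γ ↦ -γ`
  have hre : ∑ γ, conj (χ q γ) * ⟪u, V γ v⟫_ℂ = ∑ γ, conj (χ q (-γ)) * ⟪u, V (-γ) v⟫_ℂ :=
    (Fintype.sum_equiv (Equiv.neg Γ) _ _ (fun γ => by simp)).symm
  rw [hre]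
  refine Finset.sum_congr rfl fun γ _ => ?_
  rw [inner_rep_left V hV0 hVadd hVnorm γ u v]
  congr 1
  rw [hχconj, neg_neg]

omit [DecidableEq Γ] in
/-- `Π_q` is self-adjoint as an element of the C⋆-algebra `E →L[ℂ] E`. [folklore] -/
theorem isSelfAdjoint_proj [CompleteSpace E] (hχconj : ∀ q γ, conj (χ q γ) = χ q (-γ))
    (hV0 : V 0 = 1) (hVadd : ∀ γ γ', V (γ + γ') = V γ * V γ') (hVnorm : ∀ γ v, ‖V γ v‖ = ‖v‖)
    (hPr : ∀ q, Pr q = ((Fintype.card Γ : ℂ)⁻¹) • ∑ γ, conj (χ q γ) • V γ) (q : Γ) :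
    IsSelfAdjoint (Pr q) := by
  rw [ContinuousLinearMap.isSelfAdjoint_iff', eq_comm, ContinuousLinearMap.eq_adjoint_iff]
  intro x y
  exact inner_proj_left χ V Pr hχconj hV0 hVadd hVnorm hPr q x y

omit [DecidableEq Γ] in
/-- `‖Π_q v‖ ≤ ‖v‖`. [folklore] -/
theorem norm_proj_le (hχadd : ∀ q γ γ', χ q (γ + γ') = χ q γ * χ q γ') (hχzero : ∀ q, χ q 0 = 1)
    (hχconj : ∀ q γ, conj (χ q γ) = χ q (-γ)) (hVnorm : ∀ γ v, ‖V γ v‖ = ‖v‖)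
    (hPr : ∀ q, Pr q = ((Fintype.card Γ : ℂ)⁻¹) • ∑ γ, conj (χ q γ) • V γ) (q : Γ) (v : E) :
    ‖Pr q v‖ ≤ ‖v‖ := by
  have hcard : (0 : ℝ) < Fintype.card Γ := Nat.cast_pos.2 Fintype.card_pos
  rw [hPr q, smul_apply, _root_.sum_apply, norm_smul, norm_inv, Complex.norm_natCast]
  have hle : ‖∑ γ, (conj (χ q γ) • V γ) v‖ ≤ ∑ γ : Γ, ‖v‖ := by
    refine (norm_sum_le _ _).trans (Finset.sum_le_sum fun γ _ => ?_)
    rw [smul_apply, norm_smul, RCLike.norm_conj, norm_bichar χ hχadd hχzero hχconj, one_mul, hVnorm]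
  rw [Finset.sum_const, Finset.card_univ, nsmul_eq_mul] at hle
  calc (Fintype.card Γ : ℝ)⁻¹ * ‖∑ γ, (conj (χ q γ) • V γ) v‖ ≤ (Fintype.card Γ : ℝ)⁻¹ * (Fintype.card Γ * ‖v‖) :=
        mul_le_mul_of_nonneg_left hle (inv_nonneg.2 hcard.le)
    _ = ‖v‖ := by field_simp

omit [AddCommGroup Γ] [DecidableEq Γ] in
/-- `P` commuting with every `V(γ)` commutes with every `Π_q`. [folklore] -/
theorem comm_proj (P : E →L[ℂ] E) (hPV : ∀ γ, P * V γ = V γ * P)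
    (hPr : ∀ q, Pr q = ((Fintype.card Γ : ℂ)⁻¹) • ∑ γ, conj (χ q γ) • V γ) (q : Γ) :
    P * Pr q = Pr q * P := by
  rw [hPr q, mul_smul_comm, smul_mul_assoc, Finset.mul_sum, Finset.sum_mul]
  congr 1
  refine Finset.sum_congr rfl fun γ _ => ?_
  rw [mul_smul_comm, smul_mul_assoc, hPV]

/-- Pythagoras over the isotypic decomposition: `‖v‖² = Σ_q ‖Π_q v‖²`. [folklore] -/
theorem norm_sq_eq_sum_norm_sq_proj (hχadd : ∀ q γ γ', χ q (γ + γ') = χ q γ * χ q γ')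
    (hχconj : ∀ q γ, conj (χ q γ) = χ q (-γ))
    (hχorth : ∀ q q', ∑ γ, χ q γ * conj (χ q' γ) = if q = q' then (Fintype.card Γ : ℂ) else 0)
    (hχdual : ∀ γ, ∑ q, conj (χ q γ) = if γ = 0 then (Fintype.card Γ : ℂ) else 0)
    (hV0 : V 0 = 1) (hVadd : ∀ γ γ', V (γ + γ') = V γ * V γ') (hVnorm : ∀ γ v, ‖V γ v‖ = ‖v‖)
    (hPr : ∀ q, Pr q = ((Fintype.card Γ : ℂ)⁻¹) • ∑ γ, conj (χ q γ) • V γ) (v : E) :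
    ‖v‖ ^ 2 = ∑ q, ‖Pr q v‖ ^ 2 := by
  have hdec : v = ∑ q, Pr q v := by
    rw [← _root_.sum_apply, sum_proj χ V Pr hχdual hV0 hPr, one_apply_eq_self]
  have horth : ∀ q q', q ≠ q' → ⟪Pr q v, Pr q' v⟫_ℂ = 0 := fun q q' hne => by
    rw [inner_proj_left χ V Pr hχconj hV0 hVadd hVnorm hPr, ← mul_apply_eq_comp,
      proj_mul_proj χ V Pr hχadd hχconj hχorth hVadd hPr, if_neg hne, zero_apply, inner_zero_right]
  have key : (‖v‖ ^ 2 : ℂ) = ∑ q, (‖Pr q v‖ ^ 2 : ℂ) := by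
    have h1 : ((‖v‖ ^ 2 : ℝ) : ℂ) = ⟪v, v⟫_ℂ := by rw [inner_self_eq_norm_sq_to_K]; norm_cast
    push_cast at h1
    rw [h1]
    conv_lhs => rw [hdec]
    rw [sum_inner, Finset.sum_congr rfl]
    intro q _
    rw [inner_sum]
    rw [Finset.sum_eq_single q]
    · rw [inner_self_eq_norm_sq_to_K]; norm_cast
    · intro q' _ hne; exact horth q q' (Ne.symm hne)
    · intro h; exact absurd (Finset.mem_univ q) h
  exact_mod_cast key

end Isotypic

/-! ## §B The bicharacter of `(ℤ/N)³` -/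

section Characters

variable {N : ℕ} [NeZero N]

/-- `conj (stdAddChar a) = stdAddChar (−a)` (values on the unit circle). [folklore] -/
theorem conj_stdAddChar (a : ZMod N) : conj (ZMod.stdAddChar a) = ZMod.stdAddChar (-a) := by
  rw [ZMod.stdAddChar_apply, ZMod.stdAddChar_apply, AddChar.map_neg_eq_inv, Circle.coe_inv_eq_conj]

/-- `stdAddChar a = 1 ↔ a = 0`. [folklore] -/
theorem stdAddChar_eq_one_iff (a : ZMod N) : ZMod.stdAddChar a = 1 ↔ a = 0 := by
  constructor
  · intro h
    have h1 : ZMod.stdAddChar a = ZMod.stdAddChar (0 : ZMod N) := by rw [h, AddChar.map_zero_eq_one]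
    rw [ZMod.stdAddChar_apply, ZMod.stdAddChar_apply] at h1
    exact ZMod.injective_toCircle (Subtype.coe_injective h1)
  · rintro rfl; exact AddChar.map_zero_eq_one _

/-- Orthogonality of `ZMod.stdAddChar` twisted by `d`: `Σ_a stdAddChar (d a) = N·[d = 0]`. [folklore] -/
theorem sum_stdAddChar_mul (d : ZMod N) :
    ∑ a : ZMod N, ZMod.stdAddChar (d * a) = if d = 0 then (N : ℂ) else 0 := by
  classical
  by_cases hd : d = 0
  · subst hd
    simp [AddChar.map_zero_eq_one]
  · have h := AddChar.sum_eq_ite ((ZMod.stdAddChar (N := N)).mulShift d)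
    simp only [AddChar.mulShift_apply, ZMod.card] at h
    rw [h, if_neg hd, if_neg]
    intro h0
    -- `mulShift d = 0` forces `stdAddChar d = 1`, i.e. `d = 0`
    have h1 : ZMod.stdAddChar (d * 1) = 1 := by
      have := congrArg (fun ψ : AddChar (ZMod N) ℂ => ψ 1) h0
      simpa [AddChar.mulShift_apply] using this
    rw [mul_one, stdAddChar_eq_one_iff] at h1
    exact hd h1

/-- The bicharacter `χ_q(γ) = Π_k stdAddChar (q_k γ_k)` of `(ℤ/N)³` is multiplicative in `γ`. [folklore] -/
theorem bichar_add (q γ γ' : Fin 3 → ZMod N) :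
    (∏ k, ZMod.stdAddChar (q k * (γ + γ') k)) = (∏ k, ZMod.stdAddChar (q k * γ k)) * ∏ k, ZMod.stdAddChar (q k * γ' k) := by
  rw [← Finset.prod_mul_distrib]
  refine Finset.prod_congr rfl fun k _ => ?_
  rw [Pi.add_apply, mul_add, AddChar.map_add_eq_mul]

/-- `χ_q(0) = 1`. [folklore] -/
theorem bichar_zero (q : Fin 3 → ZMod N) : (∏ k, ZMod.stdAddChar (q k * (0 : Fin 3 → ZMod N) k)) = 1 := by
  simp [AddChar.map_zero_eq_one]

/-- `conj χ_q(γ) = χ_q(−γ)`. [folklore] -/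
theorem bichar_conj (q γ : Fin 3 → ZMod N) :
    conj (∏ k, ZMod.stdAddChar (q k * γ k)) = ∏ k, ZMod.stdAddChar (q k * (-γ) k) := by
  rw [map_prod]
  refine Finset.prod_congr rfl fun k _ => ?_
  rw [conj_stdAddChar, Pi.neg_apply, mul_neg]

/-- `χ` is symmetric: `χ_q(γ) = χ_γ(q)`. [folklore] -/
theorem bichar_symm (q γ : Fin 3 → ZMod N) :
    (∏ k, ZMod.stdAddChar (q k * γ k)) = ∏ k, ZMod.stdAddChar (γ k * q k) := by
  simp_rw [mul_comm]

/-- Orthogonality of the bicharacter: `Σ_γ χ_q(γ) conj χ_q'(γ) = N³·[q = q']`. [folklore] -/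
theorem bichar_orth (q q' : Fin 3 → ZMod N) :
    ∑ γ : Fin 3 → ZMod N, (∏ k, ZMod.stdAddChar (q k * γ k)) * conj (∏ k, ZMod.stdAddChar (q' k * γ k)) =
      if q = q' then (Fintype.card (Fin 3 → ZMod N) : ℂ) else 0 := by
  classical
  -- combine into one character twisted by `q - q'`
  have hterm : ∀ γ : Fin 3 → ZMod N, (∏ k, ZMod.stdAddChar (q k * γ k)) * conj (∏ k, ZMod.stdAddChar (q' k * γ k)) =
      ∏ k, ZMod.stdAddChar ((q - q') k * γ k) := fun γ => by
    rw [map_prod, ← Finset.prod_mul_distrib]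
    refine Finset.prod_congr rfl fun k _ => ?_
    rw [conj_stdAddChar, ← AddChar.map_add_eq_mul, Pi.sub_apply, sub_mul, ← sub_eq_add_neg]
  simp_rw [hterm]
  -- sum of a product over the coordinates = product of the coordinate sums
  have hps : ∑ γ : Fin 3 → ZMod N, ∏ k, ZMod.stdAddChar ((q - q') k * γ k) = ∏ k, ∑ a : ZMod N, ZMod.stdAddChar ((q - q') k * a) := by
    rw [Finset.prod_univ_sum, Fintype.piFinset_univ]
  rw [hps]
  simp_rw [sum_stdAddChar_mul]
  by_cases h : q = q'
  · subst h
    simp [Fintype.card_pi, ZMod.card]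
  · rw [if_neg h]
    have : ∃ k, (q - q') k ≠ 0 := by
      by_contra hall
      push Not at hall
      exact h (sub_eq_zero.1 (funext hall))
    obtain ⟨k, hk⟩ := this
    exact Finset.prod_eq_zero (Finset.mem_univ k) (if_neg hk)

/-- Dual orthogonality: `Σ_q conj χ_q(γ) = N³·[γ = 0]`. [folklore] -/
theorem bichar_dual (γ : Fin 3 → ZMod N) :
    ∑ q : Fin 3 → ZMod N, conj (∏ k, ZMod.stdAddChar (q k * γ k)) = if γ = 0 then (Fintype.card (Fin 3 → ZMod N) : ℂ) else 0 := by
  have h := bichar_orth (N := N) 0 γ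
  have h0 : ∀ q : Fin 3 → ZMod N, (∏ k, ZMod.stdAddChar ((0 : Fin 3 → ZMod N) k * q k)) = 1 := fun q => by simp [AddChar.map_zero_eq_one]
  simp_rw [h0, one_mul] at h
  simp_rw [bichar_symm _ γ]
  rw [h]
  by_cases hγ : γ = 0
  · subst hγ; simp
  · rw [if_neg hγ, if_neg (Ne.symm hγ)]

/-- The bicharacter on integer representatives is the explicit lattice phase `exp(2πi q·x/N)`. [folklore] -/
theorem bichar_intCast (q : Fin 3 → ZMod N) (x : Fin 3 → ℤ) :
    (∏ k, ZMod.stdAddChar (q k * (x k : ZMod N))) =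
      Complex.exp (2 * Real.pi * Complex.I * (∑ k, ((q k).val : ℂ) * (x k : ℂ)) / N) := by
  have hsum : 2 * (Real.pi : ℂ) * Complex.I * (∑ k, ((q k).val : ℂ) * (x k : ℂ)) / (N : ℂ) =
      ∑ k, 2 * (Real.pi : ℂ) * Complex.I * (((q k).val : ℂ) * (x k : ℂ)) / (N : ℂ) := by
    rw [Finset.mul_sum, Finset.sum_div]
  rw [hsum, Complex.exp_sum]
  refine Finset.prod_congr rfl fun k _ => ?_
  have : q k * (x k : ZMod N) = (((q k).val : ℤ) * x k : ℤ) := by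
    push_cast
    rw [ZMod.natCast_zmod_val]
  rw [this, ZMod.stdAddChar_coe]
  congr 1
  push_cast
  ring

end Characters

end Summit.QuantumFields.YangMills.Theorems.SqueezedSkewnessJointDiagonal

end
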